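import Literature.Geometry.Lorentzian.GeodesicProofs
import Mathlib.Geometry.Manifold.VectorField.LieBracket
import HarnessLib

/-!
# Coordinate frames of a chart: `D(Y ∘ γ)/dt = ∇_{γ'} Y`, `[∂ᵢ, ∂ⱼ] = 0`, the chart formula for
# `D/dt`, and smooth Christoffel data

Infrastructure for calculus in a single chart of a manifold `M` (model with corners `I` on the
real normed space `E`), phrased with Mathlib's local frame `sᵢ = e₁.localFrame b i` of `TM`
induced by the trivialisation `e₁` of `TM` at a point `x₁` and a basis `b` of `E` — the coordinate
vector fields `∂ᵢ` of the chart at `x₁` (O'Neill 1983, Ch. 1, Def. 1.9 ff.; Ch. 3, Def. 3.12,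
Prop. 3.13, Prop. 3.18). Everything is proved; the file discharges one named fact of
`Literature.Geometry.Lorentzian.Geodesic`:

* `covariantDerivAlong_comp_holds` — **the induced covariant derivative on restrictions of
  vector fields**, `D(Y ∘ γ)/dt (t₀) = ∇_{γ'(t₀)} Y` (O'Neill 1983, Ch. 3, Prop. 3.18 (3)), for
  every covariant derivative on `TM`, from the expansion `cov_apply_eq_sum_localFrame` of `∇_v Y`
  in a local frame (locality, additivity, Leibniz rule) and the chain rule for the coefficient
  functions.

and provides, for the later files on flat metrics (parallel frames, isometric charts):

* `localFrame_trivializationAt_eq_mpullback` — `sᵢ` is the pullback (`VectorField.mpullback`)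
  of the constant field `bᵢ` along the extended chart `φ` at `x₁` (`TangentBundle.symmL_trivializationAt`);
  hence `mlieBracket_localFrame_trivializationAt` — **the coordinate fields commute**,
  `[∂ᵢ, ∂ⱼ] = 0` on the chart domain (pullback by the chart commutes with the bracket,
  `VectorField.mpullback_mlieBracket`; O'Neill 1983, Ch. 1, Lemma 1.18 ff.);
* `chartPosition x₁ = ∑ (xⁱ - xⁱ(x₁)) ∂ᵢ`, the position (Euler) field of the chart centred at
  `x₁` (pullback of `u ↦ u - φ x₁`), smooth on the chart domain, vanishing at `x₁`, with
  `mlieBracket_chartPosition_localFrame` — `[P, ∂ⱼ] = -∂ⱼ`;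
* `continuousLinearMapAt_covariantDerivAlong_sum_smul` — **the chart formula for `D/dt` of a
  frame combination** `W = ∑ cⁱ(t) sᵢ(γ t)`: `A (DW/dt) = ∑ (cⁱ)' bᵢ + ∑ cⁱ Ĉᵢ(γ t) U` (O'Neill
  1983, Ch. 3, Prop. 3.18, the coordinate formula of the proof), where `A = e₁|_{γ t}`, `U = A γ'`
  and `Ĉᵢ` reads `w ↦ ∇_w sᵢ` in `e₁` (generalising `continuousLinearMapAt_covariantDerivAlong_velocity`
  of `GeodesicExistence.lean` from `W = γ'` to arbitrary frame combinations), together with the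
  differentiability of the lift of such a `W` to `TM` (`mdifferentiableAt_lift_sum_smul_localFrame`);
* `exists_contMDiffOn_christoffel` — **`C^k` Christoffel data on the whole chart domain** for a
  locally `C^k` connection (`CovariantDerivative.IsLocallyContMDiff k`, e.g. every Levi-Civita
  connection of a smooth metric, `IsLeviCivita.isLocallyContMDiff`): maps `Ĉᵢ`, `C^k` on the
  chart domain of `x₁`, reading `w ↦ ∇_w sᵢ` in `e₁` there (compare `exists_christoffelChart` of
  `GeodesicProofs.lean`: a globally `C¹` connection, data `C¹` at the centre only).

## References

* B. O'Neill, *Semi-Riemannian geometry with applications to relativity*, Academic Press 1983,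
  Ch. 1, Def. 1.9 ff. (coordinate vector fields), Lemma 1.18 ff. (their brackets); Ch. 3,
  Def. 3.12 and Prop. 3.13 (Christoffel symbols, `D_{∂ᵢ} ∂ⱼ = ∑ Γᵏᵢⱼ ∂ₖ`), Prop. 3.18 (induced
  covariant derivative on curves; (3): `(V_α)' = D_{α'} V`; coordinate formula in the proof,
  p. 66) (key `ONeill1983`).
-/

noncomputable section

open Bundle Set Filter VectorField
open scoped Manifold ContDiff Topology

namespace Literature.Geometry.Lorentzian

variable {E : Type*} [NormedAddCommGroup E] [NormedSpace ℝ E] {H : Type*} [TopologicalSpace H]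
  {I : ModelWithCorners ℝ E H} {M : Type*} [TopologicalSpace M] [ChartedSpace H M]
  [IsManifold I ∞ M]

/-! ### The covariant derivative of a field expanded in a local frame -/

section Comp

variable [FiniteDimensional ℝ E] (cov : CovariantDerivative I E (TangentSpace I : M → Type _))

/-- **`∇_v Y` in a local frame** (O'Neill 1983, Ch. 3, Prop. 3.13 / proof of Prop. 3.18:
`D_V(∑ Wⁱ ∂ᵢ) = ∑ V(Wⁱ) ∂ᵢ + ∑ Wⁱ D_V ∂ᵢ`). For a vector field `Y` differentiable at a point `x`
of the base set of an atlas trivialisation `e` with local frame `sᵢ = e.localFrame b i` and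
coefficient functions `fⁱ(y) = e.localFrame_coeff I b i y (Y y)`, one has
`∇_v Y = ∑ᵢ (fⁱ(x) ∇_v sᵢ + dfⁱ_x(v) sᵢ(x))`: locality of `∇` (`Y = ∑ fⁱ sᵢ` near `x`), additivity
and the Leibniz rule. [cite: ONeill1983, Ch. 3, Prop. 3.18] -/
theorem cov_apply_eq_sum_localFrame {ι : Type*} [Fintype ι]
    (e : Trivialization E (TotalSpace.proj : TangentBundle I M → M)) [MemTrivializationAtlas e]
    (b : Module.Basis ι ℝ E) {Y : Π x : M, TangentSpace I x} {x : M} (hx : x ∈ e.baseSet)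
    (hY : MDiffAt (T% Y) x) (v : TangentSpace I x) :
    cov Y x v = ∑ i, (e.localFrame_coeff I b i x (Y x) • cov (e.localFrame b i) x v +
      (show ℝ from mfderiv I 𝓘(ℝ, ℝ) (fun y ↦ e.localFrame_coeff I b i y (Y y)) x v) •
        e.localFrame b i x) := by
  set s : ι → Π y : M, TangentSpace I y := e.localFrame b with hs_def
  set f : ι → M → ℝ := fun i y ↦ e.localFrame_coeff I b i y (Y y) with hf_def
  have hs : ∀ i, MDiffAt (T% (s i)) x := fun i ↦
    (contMDiffAt_localFrame_of_mem 1 e b i hx).mdifferentiableAt one_ne_zero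
  have hf : ∀ i, MDifferentiableAt I 𝓘(ℝ, ℝ) (f i) x := fun i ↦
    mdifferentiableAt_localFrame_coeff (I := I) (e := e) b hx hY i
  have hσ : ∀ i, MDiffAt (T% ((f i) • (s i))) x := fun i ↦ (hf i).smul_section (hs i)
  have hsum : MDiffAt (T% (∑ i, (f i) • (s i))) x := by
    have := MDifferentiableAt.sum_section (I := I) (E := (TangentSpace I : M → Type _))
      (s := Finset.univ) (t := fun i ↦ (f i) • (s i)) (x₀ := x) (fun i _ ↦ hσ i)
    convert this using 2
    ext
    · rfl
    · simp [Finset.sum_apply]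
  have h1 : cov Y x = cov (∑ i, (f i) • (s i)) x := by
    refine cov.isCovariantDerivativeOn.congr_of_eventuallyEq (s := univ) hY hsum univ_mem ?_
    filter_upwards [e.open_baseSet.mem_nhds hx] with y hy
    rw [e.eq_sum_localFrame_coeff_smul (I := I) (b := b) (s := Y) hy]
    simp [Finset.sum_apply, hf_def, hs_def]
  rw [h1, covariantDerivative_finset_sum cov _ _ (fun i _ ↦ hσ i), _root_.sum_apply]
  refine Finset.sum_congr rfl fun i _ ↦ ?_
  rw [cov.isCovariantDerivativeOn.leibniz (hs i) (hf i)]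
  simp only [_root_.add_apply, FunLike.coe_smul, Pi.smul_apply,
    ContinuousLinearMap.smulRight_apply]
  rfl

/-- **The induced covariant derivative on restrictions of vector fields** (discharge of the named
fact `covariantDerivAlong_comp`; O'Neill 1983, Ch. 3, Prop. 3.18 (3), p. 65: "`(V_α)' = D_{α'} V`
for `V ∈ 𝔛(M)`", proof p. 66 via the coordinate formula `Z' = ∑ (dZⁱ/dt) ∂ᵢ + ∑ Zⁱ D_{α'} ∂ᵢ`).
For a vector field `Y` differentiable at `γ t₀` and `γ` differentiable at `t₀`,
`D(Y ∘ γ)/dt (t₀) = ∇_{γ'(t₀)} Y`: in the canonical frame at `γ t₀` the coefficient functions of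
`Y ∘ γ` are `fⁱ ∘ γ` with `fⁱ` the coefficient functions of `Y`, so `(fⁱ ∘ γ)' = dfⁱ(γ')`
(chain rule, `hasDerivAt_comp_curve`), and the frame formula is the expansion
`cov_apply_eq_sum_localFrame` of `∇_{γ'} Y`. [cite: ONeill1983, Ch. 3, Prop. 3.18 (3)] -/
theorem covariantDerivAlong_comp_holds : covariantDerivAlong_comp (I := I) (M := M) cov := by
  intro γ Y t₀ hγ hY
  set e := trivializationAt E (TangentSpace I : M → Type _) (γ t₀) with he_def
  set b := Module.finBasis ℝ E with hb_def
  have he : γ t₀ ∈ e.baseSet := FiberBundle.mem_baseSet_trivializationAt' (γ t₀)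
  have hf : ∀ i, MDifferentiableAt I 𝓘(ℝ, ℝ) (fun y ↦ e.localFrame_coeff I b i y (Y y)) (γ t₀) :=
    fun i ↦ mdifferentiableAt_localFrame_coeff (I := I) (e := e) b he hY i
  have hd : ∀ i, deriv (fun t ↦ e.localFrame_coeff I b i (γ t) (Y (γ t))) t₀ =
      mfderiv I 𝓘(ℝ, ℝ) (fun y ↦ e.localFrame_coeff I b i y (Y y)) (γ t₀) (velocity I γ t₀) :=
    fun i ↦ (hasDerivAt_comp_curve (f := fun y ↦ e.localFrame_coeff I b i y (Y y)) (hf i) hγ).deriv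
  rw [covariantDerivAlong_def, cov_apply_eq_sum_localFrame cov e b he hY, Finset.sum_add_distrib]
  simp only [covariantDerivAlongFrame, ← he_def, ← hb_def, hd]
  rw [add_comm]

end Comp

/-! ### The coordinate frame of a chart as a pullback, and its Lie brackets -/

section Frames

/-- **The coordinate vector fields are the pulled-back constant fields.** On the domain of the
chart at `x₁`, the local frame `sᵢ` of `TM` induced by the trivialisation at `x₁` and a basis `b`
of `E` (Mathlib's `Trivialization.localFrame`, i.e. `sᵢ(y) = e₁.symm y bᵢ`) is the pullback of the
constant vector field `bᵢ` of `E` along the extended chart `φ = extChartAt I x₁`: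
`sᵢ(y) = (dφ_y)⁻¹ bᵢ = ∂ᵢ|_y` (the trivialisation of `TM` at `x₁` is `dφ`,
`TangentBundle.symmL_trivializationAt`). O'Neill 1983, Ch. 1, Def. 1.9 ff. (coordinate vector
fields `∂ᵢ = ∂/∂xⁱ` of a chart). [cite: ONeill1983, Ch. 1, Def. 1.9 ff] -/
theorem localFrame_trivializationAt_eq_mpullback {ι : Type*} (b : Module.Basis ι ℝ E) {x₁ y : M}
    (hy : y ∈ (chartAt H x₁).source) (i : ι) :
    (trivializationAt E (TangentSpace I) x₁).localFrame b i y =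
      mpullback I 𝓘(ℝ, E) (extChartAt I x₁) (fun _ ↦ b i) y := by
  have hye : y ∈ (trivializationAt E (TangentSpace I) x₁).baseSet := by simpa using hy
  have hy' : y ∈ (extChartAt I x₁).source := by rwa [extChartAt_source]
  have hinv : (mfderiv I 𝓘(ℝ, E) (extChartAt I x₁) y).inverse =
      mfderivWithin 𝓘(ℝ, E) I (extChartAt I x₁).symm (range I) (extChartAt I x₁ y) :=
    ContinuousLinearMap.inverse_eq (mfderiv_extChartAt_comp_mfderivWithin_extChartAt_symm' hy')
      (mfderivWithin_extChartAt_symm_comp_mfderiv_extChartAt' hy')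
  have h2 := DFunLike.congr_fun (TangentBundle.symmL_trivializationAt (𝕜 := ℝ) (I := I) hy) (b i)
  rw [Trivialization.symmL_apply _ hye] at h2
  rw [Trivialization.localFrame_apply_of_mem_baseSet _ b hye, mpullback_apply, hinv]
  have h3 : (trivializationAt E (TangentSpace I) x₁).basisAt b hye i =
      (trivializationAt E (TangentSpace I) x₁).symm y (b i) := by
    simp [Trivialization.basisAt]
  rw [h3]
  exact h2

/-- The constant vector fields of a normed space commute: `[v, w] = 0` (both derivatives in
`[V, W] = DW(V) - DV(W)` vanish). [folklore] -/
theorem mlieBracket_const_const (v w : E) :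
    mlieBracket 𝓘(ℝ, E) (fun x : E ↦ (v : TangentSpace 𝓘(ℝ, E) x)) (fun _ ↦ w) = 0 := by
  ext x
  rw [← mlieBracketWithin_univ, mlieBracketWithin_eq_lieBracketWithin, lieBracketWithin_eq]
  simp
  rfl

/-- **The coordinate vector fields commute**: `[∂ᵢ, ∂ⱼ] = 0` on the chart domain (O'Neill 1983,
Ch. 1, Lemma 1.18 ff.: brackets of coordinate vector fields vanish, by equality of mixed partial
derivatives). In the tree's terms: the Lie bracket (Mathlib's `VectorField.mlieBracket`) of two
members of the local frame of `TM` induced by the trivialisation at `x₁` vanishes at every point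
of the chart domain of `x₁` — both are pullbacks of constant fields along the chart
(`localFrame_trivializationAt_eq_mpullback`), pullback by the (`C^∞`) chart commutes with the
bracket (Mathlib's `VectorField.mpullback_mlieBracket`, where the symmetry of second derivatives
is used), and constant fields commute. [cite: ONeill1983, Ch. 1, Lemma 1.18 ff] -/
theorem mlieBracket_localFrame_trivializationAt [CompleteSpace E] {ι : Type*}
    (b : Module.Basis ι ℝ E) {x₁ y : M} (hy : y ∈ (chartAt H x₁).source) (i j : ι) :
    mlieBracket I ((trivializationAt E (TangentSpace I) x₁).localFrame b i)
      ((trivializationAt E (TangentSpace I) x₁).localFrame b j) y = 0 := by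
  haveI : IsManifold I (minSmoothness ℝ 2) M := by
    rw [minSmoothness_of_isRCLikeNormedField]; infer_instance
  have heq : ∀ k, (trivializationAt E (TangentSpace I) x₁).localFrame b k =ᶠ[𝓝 y]
      mpullback I 𝓘(ℝ, E) (extChartAt I x₁) (fun _ ↦ b k) := fun k ↦ by
    filter_upwards [(chartAt H x₁).open_source.mem_nhds hy] with z hz
    exact localFrame_trivializationAt_eq_mpullback b hz k
  have hc := fun k ↦
    ((contMDiffAt_vectorSpace_iff_contDiffAt (𝕜 := ℝ) (V := fun x : E ↦ (b k : TangentSpace 𝓘(ℝ, E) x))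
      (n := 1) (x := extChartAt I x₁ y)).2 contDiffAt_const).mdifferentiableAt one_ne_zero
  rw [(heq i).mlieBracket_vectorField_eq (heq j),
    ← mpullback_mlieBracket (hc i) (hc j) (contMDiffAt_extChartAt' (n := ∞) hy)
      (by rw [minSmoothness_of_isRCLikeNormedField]; exact WithTop.coe_le_coe.2 le_top),
    mlieBracket_const_const, mpullback_zero]
  rfl

/-- **The position vector field of a chart.** `chartPosition x₁ y = (dφ_y)⁻¹ (φ y - φ x₁)`, the
pullback along the extended chart `φ` at `x₁` of the affine vector field `u ↦ u - φ x₁` of `E`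
(the radial, or Euler, field `∑ (xⁱ - xⁱ(x₁)) ∂ᵢ` of the chart centred at `x₁`; junk outside the
chart domain). Used to transport the radial parallel transport equation. [folklore] -/
def chartPosition (x₁ : M) : Π y : M, TangentSpace I y :=
  mpullback I 𝓘(ℝ, E) (extChartAt I x₁) (fun u ↦ (u - extChartAt I x₁ x₁ : E))

omit [IsManifold I ∞ M] in
/-- Unfolding lemma for `chartPosition`. [folklore] -/
theorem chartPosition_apply (x₁ y : M) :
    chartPosition (I := I) x₁ y =
      (mfderiv I 𝓘(ℝ, E) (extChartAt I x₁) y).inverse (extChartAt I x₁ y - extChartAt I x₁ x₁) :=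
  rfl

/-- The position field in the coordinate frame: `chartPosition x₁ y = ∑ᵢ (φ y - φ x₁)ⁱ sᵢ(y)` on
the chart domain, i.e. `∑ (xⁱ - xⁱ(x₁)) ∂ᵢ`. [folklore] -/
theorem chartPosition_eq_sum_localFrame {ι : Type*} [Fintype ι] (b : Module.Basis ι ℝ E)
    {x₁ y : M} (hy : y ∈ (chartAt H x₁).source) :
    chartPosition (I := I) x₁ y =
      ∑ i, b.repr (extChartAt I x₁ y - extChartAt I x₁ x₁) i •
        (trivializationAt E (TangentSpace I) x₁).localFrame b i y := by
  rw [chartPosition_apply]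
  obtain ⟨L, hL⟩ : ∃ L : E →L[ℝ] TangentSpace I y,
      ∀ v : E, L v = (mfderiv I 𝓘(ℝ, E) (extChartAt I x₁) y).inverse v :=
    ⟨(mfderiv I 𝓘(ℝ, E) (extChartAt I x₁) y).inverse, fun _ ↦ rfl⟩
  simp_rw [localFrame_trivializationAt_eq_mpullback b hy, mpullback_apply, ← hL]
  conv_lhs => rw [← b.sum_repr (extChartAt I x₁ y - extChartAt I x₁ x₁)]
  rw [map_sum]
  simp_rw [map_smul]

/-- The affine field `u ↦ u - c` and a constant field `w` of a normed space have bracket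
`[u - c, w] = -w` (`[V, W] = DW(V) - DV(W)` with `DW = 0`, `DV = id`). [folklore] -/
theorem mlieBracket_sub_const_const (c w : E) :
    mlieBracket 𝓘(ℝ, E) (fun u : E ↦ (u - c : TangentSpace 𝓘(ℝ, E) u)) (fun _ ↦ w) =
      fun _ ↦ -w := by
  ext x
  rw [← mlieBracketWithin_univ, mlieBracketWithin_eq_lieBracketWithin, lieBracketWithin_eq]
  have h : fderivWithin ℝ (fun u : E ↦ u - c) univ x = ContinuousLinearMap.id ℝ E := by
    rw [fderivWithin_univ]
    exact ((hasFDerivAt_id x).sub_const c).fderiv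
  simp [h]

/-- **The position field and the coordinate fields: `[P, ∂ⱼ] = -∂ⱼ`** on the chart domain
(`P = ∑ (xⁱ - xⁱ(x₁)) ∂ᵢ`, so `[P, ∂ⱼ] = -∑ ∂ⱼ(xⁱ) ∂ᵢ = -∂ⱼ` as the `∂ᵢ` commute; here: both
fields are pullbacks along the chart, of `u - φ x₁` and of the constant `bⱼ`, whose bracket is
`-bⱼ`). [folklore] -/
theorem mlieBracket_chartPosition_localFrame [CompleteSpace E] {ι : Type*}
    (b : Module.Basis ι ℝ E) {x₁ y : M} (hy : y ∈ (chartAt H x₁).source) (j : ι) :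
    mlieBracket I (chartPosition x₁) ((trivializationAt E (TangentSpace I) x₁).localFrame b j) y =
      -(trivializationAt E (TangentSpace I) x₁).localFrame b j y := by
  haveI : IsManifold I (minSmoothness ℝ 2) M := by
    rw [minSmoothness_of_isRCLikeNormedField]; infer_instance
  have heq : (trivializationAt E (TangentSpace I) x₁).localFrame b j =ᶠ[𝓝 y]
      mpullback I 𝓘(ℝ, E) (extChartAt I x₁) (fun _ ↦ b j) := by
    filter_upwards [(chartAt H x₁).open_source.mem_nhds hy] with z hz
    exact localFrame_trivializationAt_eq_mpullback b hz j
  have hc :=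
    ((contMDiffAt_vectorSpace_iff_contDiffAt (𝕜 := ℝ) (V := fun x : E ↦ (b j : TangentSpace 𝓘(ℝ, E) x))
      (n := 1) (x := extChartAt I x₁ y)).2 contDiffAt_const).mdifferentiableAt one_ne_zero
  have hp :=
    ((contMDiffAt_vectorSpace_iff_contDiffAt (𝕜 := ℝ)
      (V := fun u : E ↦ (u - extChartAt I x₁ x₁ : TangentSpace 𝓘(ℝ, E) u)) (n := 1)
      (x := extChartAt I x₁ y)).2
      (contDiffAt_id.sub contDiffAt_const)).mdifferentiableAt one_ne_zero
  rw [(Filter.EventuallyEq.rfl (f := chartPosition (I := I) x₁)).mlieBracket_vectorField_eq heq,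
    chartPosition, ← mpullback_mlieBracket hp hc (contMDiffAt_extChartAt' (n := ∞) hy)
      (by rw [minSmoothness_of_isRCLikeNormedField]; exact WithTop.coe_le_coe.2 le_top),
    mlieBracket_sub_const_const, localFrame_trivializationAt_eq_mpullback b hy,
    ← mpullback_neg_apply]
  rfl

omit [IsManifold I ∞ M] in
/-- The position field vanishes at the centre of the chart. [folklore] -/
theorem chartPosition_self (x₁ : M) : chartPosition (I := I) x₁ x₁ = 0 := by
  rw [chartPosition_apply, sub_self]
  exact map_zero _

/-- The position field of the chart at `x₁` is smooth on the chart domain (pullback of a smooth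
field along the smooth chart, whose derivative is invertible there). [folklore] -/
theorem contMDiffAt_chartPosition [CompleteSpace E] {x₁ y : M} (hy : y ∈ (chartAt H x₁).source) :
    CMDiffAt ∞ (T% (chartPosition (I := I) x₁)) y := by
  have hp := (contMDiffAt_vectorSpace_iff_contDiffAt (𝕜 := ℝ)
      (V := fun u : E ↦ (u - extChartAt I x₁ x₁ : TangentSpace 𝓘(ℝ, E) u)) (n := ∞)
      (x := extChartAt I x₁ y)).2 (contDiffAt_id.sub contDiffAt_const)
  have hy' : y ∈ (extChartAt I x₁).source := by rwa [extChartAt_source]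
  exact hp.mpullback_vectorField_preimage (contMDiffAt_extChartAt' (n := ∞) hy)
    (isInvertible_mfderiv_extChartAt hy') le_rfl

end Frames

/-! ### Fields expanded in the coordinate frame: trivialisation, lift, and `D/dt` in a chart -/

section ChartFormula

variable [FiniteDimensional ℝ E] (cov : CovariantDerivative I E (TangentSpace I : M → Type _))

omit [FiniteDimensional ℝ E] in
/-- The trivialisation at `x₁` reads the frame vector `sⱼ(y)` as `bⱼ`. [folklore] -/
theorem continuousLinearMapAt_localFrame {ι : Type*} (b : Module.Basis ι ℝ E) {x₁ y : M}
    (hy : y ∈ (chartAt H x₁).source) (j : ι) :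
    (trivializationAt E (TangentSpace I) x₁).continuousLinearMapAt ℝ y
        ((trivializationAt E (TangentSpace I) x₁).localFrame b j y) = b j := by
  have hye : y ∈ (trivializationAt E (TangentSpace I) x₁).baseSet := by simpa using hy
  rw [Trivialization.continuousLinearMapAt_apply_of_mem ℝ _ hye,
    Trivialization.localFrame_apply_of_mem_baseSet _ _ hye]
  simp only [Trivialization.basisAt, Module.Basis.map_apply, Trivialization.linearEquivAt_symm_apply]
  exact congrArg Prod.snd (Trivialization.apply_mk_symm _ hye (b j))

omit [FiniteDimensional ℝ E] in
/-- The trivialisation at `x₁` reads a frame combination `∑ cʲ sⱼ(y)` as `∑ cʲ bⱼ`. [folklore] -/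
theorem trivializationAt_sum_smul_localFrame {ι : Type*} [Fintype ι] (b : Module.Basis ι ℝ E)
    {x₁ y : M} (hy : y ∈ (chartAt H x₁).source) (c : ι → ℝ) :
    (trivializationAt E (TangentSpace I) x₁
        ⟨y, ∑ j, c j • (trivializationAt E (TangentSpace I) x₁).localFrame b j y⟩).2 =
      ∑ j, c j • b j := by
  have hye : y ∈ (trivializationAt E (TangentSpace I) x₁).baseSet := by simpa using hy
  rw [← Trivialization.continuousLinearMapAt_apply_of_mem ℝ _ hye, map_sum]
  simp only [map_smul, continuousLinearMapAt_localFrame b hy]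

omit [FiniteDimensional ℝ E] in
/-- The coefficient functions of a frame combination `∑ cʲ sⱼ` are the `cʲ`. [folklore] -/
theorem localFrame_coeff_sum_smul_localFrame {ι : Type*} [Fintype ι] (b : Module.Basis ι ℝ E)
    {x₁ y : M} (hy : y ∈ (chartAt H x₁).source) (c : ι → ℝ) (i : ι) :
    (trivializationAt E (TangentSpace I) x₁).localFrame_coeff I b i y
        (∑ j, c j • (trivializationAt E (TangentSpace I) x₁).localFrame b j y) = c i := by
  have hye : y ∈ (trivializationAt E (TangentSpace I) x₁).baseSet := by simpa using hy
  have h := Trivialization.localFrame_coeff_apply_of_mem_baseSet (I := I)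
    (trivializationAt E (TangentSpace I) x₁) b hye
    (fun _ ↦ ∑ j, c j • (trivializationAt E (TangentSpace I) x₁).localFrame b j y) i
  rw [h]
  simp only [Trivialization.localFrame_apply_of_mem_baseSet _ b hye, Module.Basis.repr_sum_self]

omit [FiniteDimensional ℝ E] in
/-- The lift to `TM` of a frame combination `t ↦ (γ t, ∑ cʲ(t) sⱼ(γ t))` with differentiable
coefficients along a differentiable curve in the chart domain is differentiable (read it in the
trivialisation at `x₁`, where it is `(γ, ∑ cʲ bⱼ)`). [folklore] -/
theorem mdifferentiableAt_lift_sum_smul_localFrame {ι : Type*} [Fintype ι]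
    (b : Module.Basis ι ℝ E) {x₁ : M} {γ : ℝ → M} {t : ℝ} (ht : γ t ∈ (chartAt H x₁).source)
    (hγ : MDifferentiableAt 𝓘(ℝ, ℝ) I γ t) {c : ι → ℝ → ℝ} (hc : ∀ i, DifferentiableAt ℝ (c i) t) :
    MDifferentiableAt 𝓘(ℝ, ℝ) I.tangent (fun t' ↦ (TotalSpace.mk' E (γ t')
      (∑ j, c j t' • (trivializationAt E (TangentSpace I) x₁).localFrame b j (γ t')) :
        TangentBundle I M)) t := by
  set e₁ := trivializationAt E (TangentSpace I : M → Type _) x₁ with he₁_def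
  have hte : γ t ∈ e₁.baseSet := by simpa [he₁_def] using ht
  rw [e₁.mdifferentiableAt_totalSpace_iff I _ (e₁.mem_source.2 hte)]
  refine ⟨hγ, ?_⟩
  have hγe : ∀ᶠ t' in 𝓝 t, γ t' ∈ (chartAt H x₁).source :=
    hγ.continuousAt.preimage_mem_nhds ((chartAt H x₁).open_source.mem_nhds ht)
  have hev : (fun t' ↦ (e₁ (TotalSpace.mk' E (γ t')
      (∑ j, c j t' • (trivializationAt E (TangentSpace I) x₁).localFrame b j (γ t')))).2) =ᶠ[𝓝 t]
      fun t' ↦ ∑ j, c j t' • b j := by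
    filter_upwards [hγe] with t' ht'
    exact trivializationAt_sum_smul_localFrame b ht' _
  refine MDifferentiableAt.congr_of_eventuallyEq ?_ hev
  exact mdifferentiableAt_iff_differentiableAt.2 (by fun_prop)

/-- **The induced covariant derivative of a frame combination, in the chart** (O'Neill 1983,
Ch. 3, Prop. 3.18, coordinate formula `Z' = ∑ (dZⁱ/dt) ∂ᵢ + ∑ Zⁱ D_{α'} ∂ᵢ` of the proof, p. 66).
Let `e₁` be the trivialisation of `TM` at `x₁` with local frame `sᵢ` and let the maps
`Ĉᵢ : M → (E →L[ℝ] E)` read `w ↦ ∇_w sᵢ` in `e₁` on a set `N` inside the chart domain (as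
provided by `exists_christoffelChart`, `exists_contMDiffOn_christoffel`). For a curve `γ`
differentiable at `t` with `γ t ∈ N` and differentiable coefficients `cⁱ`, the field
`W = ∑ cⁱ sᵢ(γ)` along `γ` has `A (DW/dt) = ∑ (cⁱ)' bᵢ + ∑ cⁱ Ĉᵢ(γ t) U`, where
`A = e₁|_{γ t}` and `U = A γ'(t)` is the velocity read in the chart: frame independence puts
`DW/dt` in the frame `sᵢ`, whose coefficient functions are the `cⁱ`.
[cite: ONeill1983, Ch. 3, Prop. 3.18] -/
theorem continuousLinearMapAt_covariantDerivAlong_sum_smul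
    {ι : Type*} [Fintype ι] (b : Module.Basis ι ℝ E) {x₁ : M} {N : Set M}
    (hN : N ⊆ (chartAt H x₁).source) (Ĉ : ι → M → (E →L[ℝ] E))
    (hĈ : ∀ y ∈ N, ∀ (i) (w : TangentSpace I y),
      Ĉ i y ((trivializationAt E (TangentSpace I) x₁).continuousLinearMapAt ℝ y w) =
        (trivializationAt E (TangentSpace I) x₁
          ⟨y, cov ((trivializationAt E (TangentSpace I) x₁).localFrame b i) y w⟩).2)
    {γ : ℝ → M} {t : ℝ} (ht : γ t ∈ N) (hγ : MDifferentiableAt 𝓘(ℝ, ℝ) I γ t)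
    {c : ι → ℝ → ℝ} (hc : ∀ i, DifferentiableAt ℝ (c i) t) :
    (trivializationAt E (TangentSpace I) x₁).continuousLinearMapAt ℝ (γ t)
        (covariantDerivAlong cov γ
          (fun t' ↦ ∑ j, c j t' • (trivializationAt E (TangentSpace I) x₁).localFrame b j (γ t'))
          t) =
      ∑ i, deriv (c i) t • b i +
        ∑ i, c i t • Ĉ i (γ t) ((trivializationAt E (TangentSpace I) x₁ ⟨γ t, velocity I γ t⟩).2) := by
  have hte : γ t ∈ (trivializationAt E (TangentSpace I) x₁).baseSet := by simpa using hN ht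
  have hW := mdifferentiableAt_lift_sum_smul_localFrame (I := I) b (hN ht) hγ hc
  -- the covariant derivative in the frame of the chart at `x₁`
  rw [covariantDerivAlong_def, ← covariantDerivAlongFrame_eq_of_mem_baseSet cov
    (trivializationAt E (TangentSpace I : M → Type _) (γ t)) (trivializationAt E (TangentSpace I) x₁)
    (Module.finBasis ℝ E) b (FiberBundle.mem_baseSet_trivializationAt' (γ t)) hte hW]
  -- the coefficient functions are the `c i`
  have hγe : ∀ᶠ t' in 𝓝 t, γ t' ∈ (chartAt H x₁).source :=
    hγ.continuousAt.preimage_mem_nhds ((chartAt H x₁).open_source.mem_nhds (hN ht))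
  have hC : ∀ i, (fun t' ↦ (trivializationAt E (TangentSpace I) x₁).localFrame_coeff I b i (γ t')
      (∑ j, c j t' • (trivializationAt E (TangentSpace I) x₁).localFrame b j (γ t'))) =ᶠ[𝓝 t]
      c i := fun i ↦ by
    filter_upwards [hγe] with t' ht'
    exact localFrame_coeff_sum_smul_localFrame b ht' _ i
  have hCd : ∀ i, deriv (fun t' ↦ (trivializationAt E (TangentSpace I) x₁).localFrame_coeff I b i
      (γ t') (∑ j, c j t' • (trivializationAt E (TangentSpace I) x₁).localFrame b j (γ t'))) t =
      deriv (c i) t := fun i ↦ (hC i).deriv_eq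
  have hCt : ∀ i, (trivializationAt E (TangentSpace I) x₁).localFrame_coeff I b i (γ t)
      (∑ j, c j t • (trivializationAt E (TangentSpace I) x₁).localFrame b j (γ t)) = c i t :=
    fun i ↦ (hC i).self_of_nhds
  -- read the frame formula through the trivialisation
  have hU : ((trivializationAt E (TangentSpace I) x₁) ⟨γ t, velocity I γ t⟩).2 =
      (trivializationAt E (TangentSpace I) x₁).continuousLinearMapAt ℝ (γ t) (velocity I γ t) :=
    (Trivialization.continuousLinearMapAt_apply_of_mem ℝ _ hte _).symm
  have h3 : ∀ i, (trivializationAt E (TangentSpace I) x₁).continuousLinearMapAt ℝ (γ t)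
      (cov ((trivializationAt E (TangentSpace I) x₁).localFrame b i) (γ t) (velocity I γ t)) =
      Ĉ i (γ t) (((trivializationAt E (TangentSpace I) x₁) ⟨γ t, velocity I γ t⟩).2) := fun i ↦ by
    rw [hU, hĈ _ ht i, Trivialization.continuousLinearMapAt_apply_of_mem ℝ _ hte]
  simp only [covariantDerivAlongFrame]
  simp only [hCd, hCt]
  simp only [map_add, map_sum, map_smul, h3, continuousLinearMapAt_localFrame b (hN ht)]

end ChartFormula

/-! ### Smooth Christoffel data of a locally smooth connection -/

section Christoffel

variable [FiniteDimensional ℝ E] (cov : CovariantDerivative I E (TangentSpace I : M → Type _))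

/-- **`C^k` Christoffel data in a chart, for a locally `C^k` connection.** For a covariant
derivative that is locally `C^k` (`cov.IsLocallyContMDiff k`: `C^{k+1}` fields on open sets go
to `C^k` sections of `Hom(TM, TM)`) and a point `x₁` there are maps `Ĉᵢ : M → (E →L[ℝ] E)`,
`C^k` on the whole chart domain of `x₁`, reading `w ↦ ∇_w sᵢ` in the trivialisation at `x₁` for
the coordinate frame `sᵢ` of the chart at `x₁` at every point of that domain; the columns
`Ĉᵢ(y) bⱼ` are the coordinates of `∇_{sⱼ} sᵢ`, i.e. the Christoffel symbols `Γᵏⱼᵢ(y)` (O'Neill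
1983, Ch. 3, Def. 3.12 / Prop. 3.13: `D_{∂ᵢ} ∂ⱼ = ∑ Γᵏᵢⱼ ∂ₖ`, smooth functions on the chart
domain). Compare `exists_christoffelChart` (a `C¹` connection in Mathlib's global sense, data `C¹`
at `x₁` only). Construction: the `Hom`-section `∇sᵢ` is `C^k` on the chart domain, hence so is
the field `∇_{sⱼ} sᵢ` (`ContMDiffOn.clm_bundle_apply`) and its `e₁`-coordinates
(`Trivialization.contMDiffOn_section_iff`); `Ĉᵢ(y)` is assembled from these columns.
[cite: ONeill1983, Ch. 3, Def. 3.12 and Prop. 3.13] -/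
theorem exists_contMDiffOn_christoffel {k : ℕ∞} (hcov : cov.IsLocallyContMDiff k)
    {ι : Type*} [Fintype ι] (b : Module.Basis ι ℝ E) (x₁ : M) :
    ∃ Ĉ : ι → M → (E →L[ℝ] E),
      (∀ y ∈ (chartAt H x₁).source, ∀ (i) (w : TangentSpace I y),
        Ĉ i y ((trivializationAt E (TangentSpace I) x₁).continuousLinearMapAt ℝ y w) =
          (trivializationAt E (TangentSpace I) x₁
            ⟨y, cov ((trivializationAt E (TangentSpace I) x₁).localFrame b i) y w⟩).2) ∧
      ∀ i, ContMDiffOn I 𝓘(ℝ, E →L[ℝ] E) k (Ĉ i) (chartAt H x₁).source := by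
  set e₁ := trivializationAt E (TangentSpace I : M → Type _) x₁ with he₁_def
  set s : ι → Π y : M, TangentSpace I y := e₁.localFrame b with hs_def
  have hbase : e₁.baseSet = (chartAt H x₁).source := by simp [he₁_def]
  -- the columns `y ↦ A (∇_{sⱼ} sᵢ)` and the assembled maps
  set col : ι → ι → M → E := fun i j y ↦ (e₁ ⟨y, cov (s i) y (s j y)⟩).2 with hcol_def
  refine ⟨fun i y ↦ ∑ j, ((b.coord j).toContinuousLinearMap).smulRight (col i j y), ?_, ?_⟩
  · intro y hy i w
    have hye : y ∈ e₁.baseSet := by rwa [hbase]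
    -- expand `w` in the frame
    have hw : w = ∑ j, b.repr (e₁.continuousLinearMapAt ℝ y w) j • s j y := by
      have h := e₁.eq_sum_localFrame_coeff_smul (I := I) (b := b) (s := fun _ ↦ w) hye
      simp only [e₁.localFrame_coeff_eq_coeff (I := I) (b := b) (s := fun _ ↦ w) hye] at h
      rw [Trivialization.continuousLinearMapAt_apply_of_mem ℝ _ hye]
      exact h
    have hA : ∀ v : TangentSpace I y, ((trivializationAt E (TangentSpace I) x₁) ⟨y, v⟩).2 =
        e₁.continuousLinearMapAt ℝ y v :=
      fun v ↦ (Trivialization.continuousLinearMapAt_apply_of_mem ℝ _ hye v).symm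
    have hA' : ∀ v : TangentSpace I y, (e₁ ⟨y, v⟩).2 = e₁.continuousLinearMapAt ℝ y v := hA
    simp only [_root_.sum_apply, ContinuousLinearMap.smulRight_apply,
      LinearMap.coe_toContinuousLinearMap', Module.Basis.coord_apply, hcol_def]
    conv_rhs => rw [hw]
    simp only [map_sum, map_smul, hA, hA']
    rfl
  · intro i
    have hu : IsOpen (chartAt H x₁).source := (chartAt H x₁).open_source
    -- the frame is smooth on the chart domain
    have hs : ∀ j, CMDiff[(chartAt H x₁).source] ∞ (T% (s j)) := fun j ↦ by
      rw [← hbase]; exact e₁.contMDiffOn_localFrame_baseSet ∞ b j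
    -- `∇ sᵢ` is a `C^k` section of `Hom(TM, TM)` on the chart domain
    have h1 : ContMDiffOn I (I.prod 𝓘(ℝ, E →L[ℝ] E)) k
        (fun y ↦ (⟨y, cov (s i) y⟩ :
          TotalSpace (E →L[ℝ] E) (fun y : M ↦ TangentSpace I y →L[ℝ] TangentSpace I y)))
        (chartAt H x₁).source :=
      (hcov _ hu).contMDiff ((hs i).of_le (by exact_mod_cast le_top))
    -- so the columns are `C^k`
    have hcol : ∀ j, ContMDiffOn I 𝓘(ℝ, E) k (col i j) (chartAt H x₁).source := fun j ↦ by
      have h2 : CMDiff[(chartAt H x₁).source] k (T% (fun y ↦ cov (s i) y (s j y))) :=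
        h1.clm_bundle_apply ((hs j).of_le (by exact_mod_cast le_top))
      exact (e₁.contMDiffOn_section_iff hu hbase.symm.subset).1 h2
    -- and so is the assembled map
    have hterm : ∀ j, ContMDiffOn I 𝓘(ℝ, E →L[ℝ] E) k
        (fun y ↦ ((b.coord j).toContinuousLinearMap).smulRight (col i j y))
        (chartAt H x₁).source := fun j ↦ by
      have hL : ContMDiff 𝓘(ℝ, E) 𝓘(ℝ, E →L[ℝ] E) k
          (fun v : E ↦ ((b.coord j).toContinuousLinearMap).smulRight v) :=
        (ContinuousLinearMap.smulRightL ℝ E E ((b.coord j).toContinuousLinearMap)).contMDiff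
      exact hL.comp_contMDiffOn (hcol j)
    exact contMDiffOn_finsetSum fun j _ ↦ hterm j

end Christoffel

end Literature.Geometry.Lorentzian

end
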